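import Summits.Ventures.YMGap.RobustBall.RobustAreaLawRowsW
import Summits.Ventures.YMGap.RobustBall.RobustSlabDoorPair
import HarnessLib

/-!
# Robust ball (Y2), area-law side — the TIER-2 area law through the PAIR slab door, and the ALL-`N` area-law rows (tiers 1 and 2)

HONEST FRAMING: venture file of the cell `pub-ymgap` (QuantumFields programme), track ROBUST-BALL (ds-4).  Two cheap consequences of the
weighted robust slab door being typed for ANY affine Kantorovich–Rubinstein contraction (`slabLawW_entry_cov_le_of_isKRContraction_weighted`):
* `areaLawOnBallW_of_pair` — engine-2's Poincaré × variance PAIR contraction `isKRContraction_slabSpecW_pair` (Holley–Stroock one-link step,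
  NO self-Lipschitz load, cross leg `√(e^{ε₀} c)`) run under Föllmer's weighted row condition: for `N ≥ 2`, a pair
  `OneLinkPoincareSUN N R c`, `OneLinkVarianceBound N R v` on the slab ball `R ≥ 2n|β/N|`, `κ > 0` and
  `e^{κ/n}·e^{ε₀}·2n|β/N|√(c v) + √(e^{ε₀} c)·ε₁ < 1` ⇒ `AreaLawOnBallW N (n+1) β κ ε₀ ε₁ mv` (tier 2: NO range cut-off, vertical window `mv`);
* the ALL-`N` rows (ROBUST-BALL-STATEMENT §8 item 12, «nobody asked yet»): fed with the tree's hypothesis-free Bakry–Émery pair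
  `(c, v) = (1/(N(1/2−R)), N/(1/2−R))` (`oneLinkPoincareSUN_bakryEmery`, `oneLinkVarianceBound_bakryEmery`, `R = 2n|β_tH| < 1/2`) the pair
  doors give, for EVERY `N ≥ 2` at once ('t Hooft coupling `β_tH`, tree coupling `N β_tH`),
  `[e^{κ/n}]·e^{ε₀} R/(1/2 − R) + e^{ε₀/2} ε₁/√(N(1/2 − R)) < 1 ⇒ AreaLawOnBall[W] N (n+1) (N β_tH) … mv`
  (`suN_areaLawOnBall_bakryEmery`, `suN_areaLawOnBallW_bakryEmery`); the row value DEcreases in `N`, so the `N = 2` certificate serves all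
  `N`.  Numeric `d = 4` rows, every `N ≥ 2`: tier 1 `(β_tH; ε₀, ε₁) = (1/64; 17/25, 17/50)` and `(1/28; 1/10, 1/10)`; tier 2 (`κ = log(6/5)`)
  `(1/64; 33/50, 33/100)` and `(1/30; 1/10, 1/10)` — exact rationals (`exp_le_taylor4`, `√(13/16) ≥ 0.9`, `(6/5)^{1/3} ≤ 1.0627`).
Strong-coupling finite-lattice statements; nothing about the continuum, a mass gap, or Clay.
-/

noncomputable section

open MeasureTheory ProbabilityTheory Real
open Literature.Probability.LatticeModels hiding glue
open Literature.Probability.LatticeModels.DobrushinMetric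
open Literature.MathematicalPhysics.QuantumLattice (fundamentalRep continuous_fundamentalRep fundamentalRep_apply)
open Literature.MathematicalPhysics.QuantumFieldTheory
open Literature.MathematicalPhysics.QuantumFieldTheory.DurhuusFrohlich
open Summit.QuantumFields.BalabanUV.InfraRed.StrongCouplingPoincareDoorSUN (OneLinkPoincareSUN oneLinkPoincareSUN_bakryEmery)
open Summit.QuantumFields.BalabanUV.InfraRed.StrongCouplingVarianceDoorSUN (OneLinkVarianceBound oneLinkVarianceBound_bakryEmery)

namespace Summit.Ventures.YMGap.RobustBall

variable {n L N : ℕ} [NeZero L]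

/-! ### The tier-2 ball area law through the pair slab door -/

section Pair

/-- **WEIGHTED SLAB COVARIANCE DECAY FOR A MEMBER OF THE TIER-2 BALL, pair engine.**  A Poincaré × variance pair on the slab ball
`R ≥ 2n|βt|`, `0 ≤ τ`, `τ n ≤ κ` and the WEIGHTED ROW CONDITION `e^{τ}·e^{ε₀}√(c v)·2n|βt| + √(e^{ε₀} c)·ε₁ < 1` give, for every
`W ∈ ClusterDomain κ ε₀ ε₁`, every direction, height, off-slab configuration, slice sites and `φ, ψ ∈ {Re, Im}`:
`|Cov_{slabLawW}(φ(Q_x̄)_{ij}, ψ(Q_ȳ⁻¹)_{kl})| ≤ 8N e^{-τ d_graph(x̄,ȳ)}` (engine-2's `isKRContraction_slabSpecW_pair` on the full neighbourhoods,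
this seat's `slabLawW_entry_cov_le_of_isKRContraction_weighted`). [cite: Follmer1988, Ch. I Corollary (2.14)] -/
theorem slabCovarianceW_of_pair (hN : 1 ≤ N) (βt : ℝ) {R c vv : ℝ} (hc : 0 ≤ c) (hvv : 0 ≤ vv)
    (hP : OneLinkPoincareSUN N R c) (hV : OneLinkVarianceBound N R vv) (hR : |βt| * (2 * (n : ℝ)) ≤ R)
    {κ τ ε₀ ε₁ : ℝ} (hκ : 0 ≤ κ) (hτ : 0 ≤ τ) (hτκ : τ * n ≤ κ) (mv : ℕ)
    (hcc : Real.exp τ * (Real.exp ε₀ * Real.sqrt (c * vv) * (2 * (n : ℝ) * |βt|)) + Real.sqrt (Real.exp ε₀ * c) * ε₁ < 1)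
    (L : ℕ) [NeZero L] (W : Perturbation (n + 1) L N) (hWball : W ∈ ClusterDomain κ ε₀ ε₁) (_hWloc : IsSlabLocal mv W)
    (v : Fin (n + 1)) (t : ZMod L) (rest : {e : Edge (n + 1) L // ¬ IsSlab v t e} → SU N) (x y : Site n L)
    (i j k l : Fin N) (φ ψ : ℂ → ℝ) (hφ : φ = Complex.re ∨ φ = Complex.im) (hψ : ψ = Complex.re ∨ ψ = Complex.im) :
    |cov[fun Q => φ ((Q x : Matrix (Fin N) (Fin N) ℂ) i j),
        fun Q => ψ ((((Q y)⁻¹ : Matrix.specialUnitaryGroup (Fin N) ℂ) : Matrix (Fin N) (Fin N) ℂ) k l);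
        slabLawW v t βt W.total rest]| ≤
      8 * N * Real.exp (-τ * torusGraphDist x y) := by
  classical
  obtain ⟨w, hosc, hlip⟩ := hWball
  have hcl : ∀ e, w.crossLipLoad κ e ≤ ε₁ := fun e =>
    le_trans (le_add_of_nonneg_left (selfLipLoad_nonneg w κ e)) (hlip e)
  refine slabLawW_entry_cov_le_of_isKRContraction_weighted hN v t (A := Real.exp ε₀ * Real.sqrt (c * vv) * |βt|)
    (B := Real.sqrt (Real.exp ε₀ * c)) (by positivity) (Real.sqrt_nonneg _) W.measurable_total W.exists_abs_total_le rest
    (fun x' => Finset.univ.erase x') (crossCoeff W w v t) (fun x' y' => crossCoeff_nonneg W w x' y') (fun hL1 => ?_) hτ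
    (fun x' => (crossCoeff_weighted_rowsum_le W w hκ hτ hτκ _ x').trans (hcl _)) ?_ hcc x y i j k l φ ψ hφ hψ
  · have h := isKRContraction_slabSpecW_pair hN hL1 v t hc hvv hR hP hV W.measurable_total W.exists_abs_total_le rest
      (fun x' => Finset.univ.erase x') (fun x' => Finset.notMem_erase x' _)
      (fun x' η η' h => siteTiltW_total_dep_univ W rest x' η η' h)
      (fun x' ω g g' => (siteTiltW_total_osc W rest w x' ω g g').trans ((oscLoad_zero_le w hκ _).trans (hosc _)))
      (crossCoeff W w v t) (fun x' y' => crossCoeff_nonneg W w x' y')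
      (fun x' y' ω η h => siteTiltW_total_cross W rest w x' y' h)
    exact h
  · calc Real.exp τ * (2 * (n : ℝ)) * (Real.exp ε₀ * Real.sqrt (c * vv) * |βt|) + Real.sqrt (Real.exp ε₀ * c) * ε₁
        = Real.exp τ * (Real.exp ε₀ * Real.sqrt (c * vv) * (2 * (n : ℝ) * |βt|)) + Real.sqrt (Real.exp ε₀ * c) * ε₁ := by ring
      _ ≤ _ := le_rfl

/-- **AREA LAW ON THE TIER-2 BALL FROM A ONE-LINK PAIR (Holley–Stroock door, weighted row condition).**  Let `N ≥ 2`, slice dimension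
`n ≥ 1`, `β` the tree coupling ('t Hooft `β/N`), `OneLinkPoincareSUN N R c` and `OneLinkVarianceBound N R v` (`0 ≤ c, v`) a pair on the slab
ball `R ≥ 2n|β/N|`, `κ > 0`, `mv ≥ 1`, and the WEIGHTED ROW CONDITION `e^{κ/n}·e^{ε₀}·(2n|β/N|√(c v)) + √(e^{ε₀} c)·ε₁ < 1`.  Then
`AreaLawOnBallW N (n+1) β κ ε₀ ε₁ mv`: Wilson's area law under EVERY member of `ClusterDomain κ ε₀ ε₁ ∩ IsSlabLocal mv` (no range cut-off),
constants uniform on the ball and in `L`, rate `κ/(2 n mv)`; no self-Lipschitz load enters. [cite: Follmer1988, Ch. I Corollary (2.14)]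
[cite: CaoNissimSheffield2025dynamical, Theorem 2.3] -/
theorem areaLawOnBallW_of_pair (hN : 2 ≤ N) (hn : 1 ≤ n) (β : ℝ) {R c vv : ℝ} (hc : 0 ≤ c) (hvv : 0 ≤ vv)
    (hP : OneLinkPoincareSUN N R c) (hV : OneLinkVarianceBound N R vv)
    (hR : |β / N| * (2 * (n : ℝ)) ≤ R) {κ ε₀ ε₁ : ℝ} (hκ : 0 < κ) {mv : ℕ} (hmv : 1 ≤ mv)
    (hrow : Real.exp (κ / n) * (Real.exp ε₀ * (2 * (n : ℝ) * |β / N| * Real.sqrt (c * vv))) +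
      Real.sqrt (Real.exp ε₀ * c) * ε₁ < 1) :
    AreaLawOnBallW N (n + 1) β κ ε₀ ε₁ mv := by
  have hn' : (0 : ℝ) < n := by exact_mod_cast (show 0 < n by omega)
  have hτ : 0 ≤ κ / n := div_nonneg hκ.le hn'.le
  have hτκ : κ / n * n ≤ κ := (div_mul_cancel₀ κ hn'.ne').le
  have hrow' : Real.exp (κ / n) * (Real.exp ε₀ * Real.sqrt (c * vv) * (2 * (n : ℝ) * |β / N|)) +
      Real.sqrt (Real.exp ε₀ * c) * ε₁ < 1 := by
    have e : Real.exp ε₀ * Real.sqrt (c * vv) * (2 * (n : ℝ) * |β / N|) =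
        Real.exp ε₀ * (2 * (n : ℝ) * |β / N| * Real.sqrt (c * vv)) := by ring
    rw [e]; exact hrow
  refine areaLawOnBallW_of_slabCovariance (n := n) hN β κ ε₀ ε₁ hmv (C₁ := 8 * N) (C₂ := κ / n) (div_pos hκ hn') ?_
  intro L _ W hWball hWloc v t rest x y i j k l φ ψ hφ hψ
  exact slabCovarianceW_of_pair (by omega) (β / N) hc hvv hP hV hR hκ.le hτ hτκ mv hrow' L W hWball hWloc v t rest
    x y i j k l φ ψ hφ hψ

end Pair

/-! ### The all-`N` rows from the Bakry–Émery pair (tier 1 and tier 2) -/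

section AllN

/-- Square-root bookkeeping of the Bakry–Émery pair `(c, v) = (1/(N D), N/D)`, `D = 1/2 − R > 0`: `√(c v) = 1/D` and
`√(e^{ε₀} c) = e^{ε₀/2}/√(N D)`. [folklore] -/
theorem bakryEmery_pair_sqrt (hN : 1 ≤ N) {D : ℝ} (hD : 0 < D) (ε₀ : ℝ) :
    Real.sqrt (1 / ((N : ℝ) * D) * ((N : ℝ) / D)) = 1 / D ∧
      Real.sqrt (Real.exp ε₀ * (1 / ((N : ℝ) * D))) = Real.exp (ε₀ / 2) / Real.sqrt ((N : ℝ) * D) := by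
  have hNpos : (0 : ℝ) < N := by exact_mod_cast (show 0 < N by omega)
  refine ⟨?_, ?_⟩
  · rw [show 1 / ((N : ℝ) * D) * ((N : ℝ) / D) = (1 / D) ^ 2 by field_simp, Real.sqrt_sq (by positivity)]
  · rw [Real.sqrt_mul (Real.exp_pos _).le, ← Real.exp_half, Real.sqrt_div' _ (mul_nonneg hNpos.le hD.le), Real.sqrt_one]
    ring

/-- **ALL `N ≥ 2` — AREA LAW ON THE TIER-1 BALL from the Bakry–Émery pair** (ROBUST-BALL-STATEMENT §8 item 12; engine-2's pair door
`areaLawOnBall_of_pair` fed with `oneLinkPoincareSUN_bakryEmery` / `oneLinkVarianceBound_bakryEmery`).  't Hooft coupling `β_tH` with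
`R = 2n|β_tH| < 1/2`, tree coupling `N β_tH`; `e^{ε₀} R/(1/2 − R) + e^{ε₀/2} ε₁/√(N(1/2 − R)) < 1 ⇒ AreaLawOnBall N (n+1) (N β_tH) ε₀ ε₁ r mv`
for every range `r` and `mv ≥ 1`.  Hypothesis-free; the row value decreases in `N`. [folklore] -/
theorem suN_areaLawOnBall_bakryEmery (hN : 2 ≤ N) {βt ε₀ ε₁ : ℝ} (h₁ : 0 ≤ ε₁)
    (hb : |βt| * (2 * (n : ℝ)) < 1 / 2) (r : ℕ) {mv : ℕ} (hmv : 1 ≤ mv)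
    (hρ : Real.exp ε₀ * (|βt| * (2 * (n : ℝ))) / (1 / 2 - |βt| * (2 * (n : ℝ))) +
      Real.exp (ε₀ / 2) * ε₁ / Real.sqrt ((N : ℝ) * (1 / 2 - |βt| * (2 * (n : ℝ)))) < 1) :
    AreaLawOnBall N (n + 1) ((N : ℝ) * βt) ε₀ ε₁ r mv := by
  set Rb : ℝ := |βt| * (2 * (n : ℝ)) with hRb
  have hNpos : (0 : ℝ) < N := by exact_mod_cast (show 0 < N by omega)
  have hD : 0 < 1 / 2 - Rb := by linarith
  have hP := oneLinkPoincareSUN_bakryEmery hN hb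
  have hV := oneLinkVarianceBound_bakryEmery hN hb
  obtain ⟨hsq1, hsq2⟩ := bakryEmery_pair_sqrt (N := N) (by omega) hD ε₀
  have hβ : |(N : ℝ) * βt / N| = |βt| := by rw [mul_div_cancel_left₀ _ hNpos.ne']
  refine areaLawOnBall_of_pair (n := n) hN ((N : ℝ) * βt) (by positivity) (by positivity) hP hV (by rw [hβ]) h₁ r hmv ?_
  rw [hβ, hsq1, hsq2]
  calc Real.exp ε₀ * (2 * (n : ℝ) * |βt| * (1 / (1 / 2 - Rb))) + Real.exp (ε₀ / 2) / Real.sqrt ((N : ℝ) * (1 / 2 - Rb)) * ε₁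
      = Real.exp ε₀ * (|βt| * (2 * (n : ℝ))) / (1 / 2 - Rb) + Real.exp (ε₀ / 2) * ε₁ / Real.sqrt ((N : ℝ) * (1 / 2 - Rb)) := by
        ring
    _ < 1 := hρ

/-- **ALL `N ≥ 2` — AREA LAW ON THE TIER-2 BALL from the Bakry–Émery pair** (weighted pair door `areaLawOnBallW_of_pair`; `n ≥ 1`, `κ > 0`):
`e^{κ/n}·e^{ε₀} R/(1/2 − R) + e^{ε₀/2} ε₁/√(N(1/2 − R)) < 1 ⇒ AreaLawOnBallW N (n+1) (N β_tH) κ ε₀ ε₁ mv`, `R = 2n|β_tH| < 1/2`, every `mv ≥ 1`.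
Hypothesis-free. [folklore] -/
theorem suN_areaLawOnBallW_bakryEmery (hN : 2 ≤ N) (hn : 1 ≤ n) {βt κ ε₀ ε₁ : ℝ} (hκ : 0 < κ)
    (hb : |βt| * (2 * (n : ℝ)) < 1 / 2) {mv : ℕ} (hmv : 1 ≤ mv)
    (hρ : Real.exp (κ / n) * (Real.exp ε₀ * (|βt| * (2 * (n : ℝ))) / (1 / 2 - |βt| * (2 * (n : ℝ)))) +
      Real.exp (ε₀ / 2) * ε₁ / Real.sqrt ((N : ℝ) * (1 / 2 - |βt| * (2 * (n : ℝ)))) < 1) :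
    AreaLawOnBallW N (n + 1) ((N : ℝ) * βt) κ ε₀ ε₁ mv := by
  set Rb : ℝ := |βt| * (2 * (n : ℝ)) with hRb
  have hNpos : (0 : ℝ) < N := by exact_mod_cast (show 0 < N by omega)
  have hD : 0 < 1 / 2 - Rb := by linarith
  have hP := oneLinkPoincareSUN_bakryEmery hN hb
  have hV := oneLinkVarianceBound_bakryEmery hN hb
  obtain ⟨hsq1, hsq2⟩ := bakryEmery_pair_sqrt (N := N) (by omega) hD ε₀
  have hβ : |(N : ℝ) * βt / N| = |βt| := by rw [mul_div_cancel_left₀ _ hNpos.ne']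
  refine areaLawOnBallW_of_pair (n := n) hN hn ((N : ℝ) * βt) (by positivity) (by positivity) hP hV (by rw [hβ]) hκ hmv ?_
  rw [hβ, hsq1, hsq2]
  calc Real.exp (κ / n) * (Real.exp ε₀ * (2 * (n : ℝ) * |βt| * (1 / (1 / 2 - Rb)))) +
        Real.exp (ε₀ / 2) / Real.sqrt ((N : ℝ) * (1 / 2 - Rb)) * ε₁
      = Real.exp (κ / n) * (Real.exp ε₀ * (|βt| * (2 * (n : ℝ))) / (1 / 2 - Rb)) +
          Real.exp (ε₀ / 2) * ε₁ / Real.sqrt ((N : ℝ) * (1 / 2 - Rb)) := by ring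
    _ < 1 := hρ

/-! ### Numeric all-`N` rows in `d = 4` (slice dimension `n = 3`, `R = 6|β_tH|`) -/

/-- `√(N D) ≥ √(2 D)` for `N ≥ 2`, in the form `s₀ ≤ √(N D)` from `s₀² ≤ 2 D`, `0 ≤ s₀`. [folklore] -/
theorem le_sqrt_nat_mul (hN : 2 ≤ N) {D s₀ : ℝ} (hD : 0 ≤ D) (hs₀ : 0 ≤ s₀) (h : s₀ ^ 2 ≤ 2 * D) :
    s₀ ≤ Real.sqrt ((N : ℝ) * D) := by
  have hN2 : (2 : ℝ) ≤ N := by exact_mod_cast hN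
  calc s₀ = Real.sqrt (s₀ ^ 2) := by rw [Real.sqrt_sq hs₀]
    _ ≤ Real.sqrt ((N : ℝ) * D) := Real.sqrt_le_sqrt (h.trans (by nlinarith))

/-- The certified all-`N` row inequality from majorants: `E₃ ≥ e^{κ/3}` (or `E₃ = e^{0}`), `E₀ ≥ e^{ε₀}`, `E_h ≥ e^{ε₀/2}`,
`0 < s₀ ≤ √(N D)`, and `E₃·E₀·q + E_h ε₁/s₀ < 1` with `q = R/D ≥ 0` give the row. [folklore] -/
theorem suN_row_lt_one_of_bounds {w ε₀ ε₁ q X E₃ E₀ Eh s₀ : ℝ} (hq : 0 ≤ q) (h₁ : 0 ≤ ε₁)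
    (hE₃ : Real.exp w ≤ E₃) (hE₀ : Real.exp ε₀ ≤ E₀) (hEh : Real.exp (ε₀ / 2) ≤ Eh) (hs₀ : 0 < s₀) (hs : s₀ ≤ Real.sqrt X)
    (h : E₃ * (E₀ * q) + Eh * ε₁ / s₀ < 1) :
    Real.exp w * (Real.exp ε₀ * q) + Real.exp (ε₀ / 2) * ε₁ / Real.sqrt X < 1 := by
  have he3 : 0 < Real.exp w := Real.exp_pos _
  have he0 : 0 < Real.exp ε₀ := Real.exp_pos _
  have heh : 0 < Real.exp (ε₀ / 2) := Real.exp_pos _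
  have h1 : Real.exp w * (Real.exp ε₀ * q) ≤ E₃ * (E₀ * q) :=
    mul_le_mul hE₃ (mul_le_mul_of_nonneg_right hE₀ hq) (by positivity) (he3.le.trans hE₃)
  have hX : 0 < Real.sqrt X := lt_of_lt_of_le hs₀ hs
  have h2 : Real.exp (ε₀ / 2) * ε₁ / Real.sqrt X ≤ Eh * ε₁ / s₀ := by
    rw [div_le_div_iff₀ hX hs₀]
    calc Real.exp (ε₀ / 2) * ε₁ * s₀ ≤ Eh * ε₁ * s₀ :=
          mul_le_mul_of_nonneg_right (mul_le_mul_of_nonneg_right hEh h₁) hs₀.le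
      _ ≤ Eh * ε₁ * Real.sqrt X := mul_le_mul_of_nonneg_left hs (by nlinarith [heh.le.trans hEh])
  linarith

/-- **ALL-`N` TIER-1 AREA-LAW ROW, `d = 4`, one-parameter ball**: 't Hooft `β_tH = 1/64` (`R = 3/32`), `(ε₀, ε₁) = (17/25, 17/50)` — for EVERY
`N ≥ 2`, every range `r` and `mv ≥ 1`: `AreaLawOnBall N 4 (N/64) (17/25) (17/50) r mv`.  Certificate (`N = 2` worst case):
`T₄(17/25)·(3/13) + T₄(17/50)·(17/50)/0.9 < 1`. [folklore] -/
theorem suN_areaLawOnBall_bakryEmery_dim4_row (hN : 2 ≤ N) (r : ℕ) {mv : ℕ} (hmv : 1 ≤ mv) :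
    AreaLawOnBall N 4 ((N : ℝ) * (1 / 64)) (17 / 25) (17 / 50) r mv := by
  show AreaLawOnBall N (3 + 1) _ _ _ r mv
  have habs : |(1 / 64 : ℝ)| * (2 * ((3 : ℕ) : ℝ)) = 3 / 32 := by rw [abs_of_pos (by norm_num)]; push_cast; norm_num
  refine suN_areaLawOnBall_bakryEmery (n := 3) hN (by norm_num) (by rw [habs]; norm_num) r hmv ?_
  rw [habs]
  have hE₀ := exp_le_taylor4 (x := (17 / 25 : ℝ)) (by norm_num) (by norm_num)
  have hEh : Real.exp ((17 / 25 : ℝ) / 2) ≤ 1 + 17 / 50 + (17 / 50) ^ 2 / 2 + (17 / 50) ^ 3 / 6 + 5 / 96 * (17 / 50) ^ 4 := by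
    rw [show ((17 / 25 : ℝ) / 2) = 17 / 50 by norm_num]; exact exp_le_taylor4 (by norm_num) (by norm_num)
  have hs := le_sqrt_nat_mul hN (D := 1 / 2 - 3 / 32) (s₀ := 9 / 10) (by norm_num) (by norm_num) (by norm_num)
  have h := suN_row_lt_one_of_bounds (w := 0) (ε₁ := 17 / 50) (q := (3 / 32) / (1 / 2 - 3 / 32)) (E₃ := 1) (by norm_num) (by norm_num)
    (by rw [Real.exp_zero]) hE₀ hEh (by norm_num) hs (by norm_num)
  rw [Real.exp_zero, one_mul] at h
  calc Real.exp (17 / 25) * (3 / 32 : ℝ) / (1 / 2 - 3 / 32) + Real.exp (17 / 25 / 2) * (17 / 50) / Real.sqrt ((N : ℝ) * (1 / 2 - 3 / 32))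
      = Real.exp (17 / 25) * ((3 / 32 : ℝ) / (1 / 2 - 3 / 32)) +
          Real.exp (17 / 25 / 2) * (17 / 50) / Real.sqrt ((N : ℝ) * (1 / 2 - 3 / 32)) := by ring
    _ < 1 := h

/-- **ALL-`N` TIER-1 AREA-LAW ROW, `d = 4`, row-1f radii**: 't Hooft `β_tH = 1/28` (`R = 3/14`), `(ε₀, ε₁) = (1/10, 1/10)` — for EVERY `N ≥ 2`,
every range `r` and `mv ≥ 1`: `AreaLawOnBall N 4 (N/28) (1/10) (1/10) r mv`.  Certificate: `T₄(1/10)·(3/4) + T₄(1/20)·(1/10)/0.755 < 1`.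
[folklore] -/
theorem suN_areaLawOnBall_bakryEmery_dim4_row' (hN : 2 ≤ N) (r : ℕ) {mv : ℕ} (hmv : 1 ≤ mv) :
    AreaLawOnBall N 4 ((N : ℝ) * (1 / 28)) (1 / 10) (1 / 10) r mv := by
  show AreaLawOnBall N (3 + 1) _ _ _ r mv
  have habs : |(1 / 28 : ℝ)| * (2 * ((3 : ℕ) : ℝ)) = 3 / 14 := by rw [abs_of_pos (by norm_num)]; push_cast; norm_num
  refine suN_areaLawOnBall_bakryEmery (n := 3) hN (by norm_num) (by rw [habs]; norm_num) r hmv ?_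
  rw [habs]
  have hE₀ := exp_le_taylor4 (x := (1 / 10 : ℝ)) (by norm_num) (by norm_num)
  have hEh : Real.exp ((1 / 10 : ℝ) / 2) ≤ 1 + 1 / 20 + (1 / 20) ^ 2 / 2 + (1 / 20) ^ 3 / 6 + 5 / 96 * (1 / 20) ^ 4 := by
    rw [show ((1 / 10 : ℝ) / 2) = 1 / 20 by norm_num]; exact exp_le_taylor4 (by norm_num) (by norm_num)
  have hs := le_sqrt_nat_mul hN (D := 1 / 2 - 3 / 14) (s₀ := 755 / 1000) (by norm_num) (by norm_num) (by norm_num)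
  have h := suN_row_lt_one_of_bounds (w := 0) (ε₁ := 1 / 10) (q := (3 / 14) / (1 / 2 - 3 / 14)) (E₃ := 1) (by norm_num) (by norm_num)
    (by rw [Real.exp_zero]) hE₀ hEh (by norm_num) hs (by norm_num)
  rw [Real.exp_zero, one_mul] at h
  calc Real.exp (1 / 10) * (3 / 14 : ℝ) / (1 / 2 - 3 / 14) + Real.exp (1 / 10 / 2) * (1 / 10) / Real.sqrt ((N : ℝ) * (1 / 2 - 3 / 14))
      = Real.exp (1 / 10) * ((3 / 14 : ℝ) / (1 / 2 - 3 / 14)) +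
          Real.exp (1 / 10 / 2) * (1 / 10) / Real.sqrt ((N : ℝ) * (1 / 2 - 3 / 14)) := by ring
    _ < 1 := h

/-- **ALL-`N` TIER-2 AREA-LAW ROW, `d = 4`, one-parameter ball**: 't Hooft `β_tH = 1/64`, weight `κ = log(6/5)`, `(ε₀, ε₁) = (33/50, 33/100)` —
for EVERY `N ≥ 2` and `mv ≥ 1`: `AreaLawOnBallW N 4 (N/64) (log(6/5)) (33/50) (33/100) mv` (no range cut-off).  Certificate:
`1.0627·T₄(33/50)·(3/13) + T₄(33/100)·(33/100)/0.9 < 1`. [folklore] -/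
theorem suN_areaLawOnBallW_bakryEmery_dim4_row (hN : 2 ≤ N) {mv : ℕ} (hmv : 1 ≤ mv) :
    AreaLawOnBallW N 4 ((N : ℝ) * (1 / 64)) (Real.log (6 / 5)) (33 / 50) (33 / 100) mv := by
  show AreaLawOnBallW N (3 + 1) _ _ _ _ mv
  have habs : |(1 / 64 : ℝ)| * (2 * ((3 : ℕ) : ℝ)) = 3 / 32 := by rw [abs_of_pos (by norm_num)]; push_cast; norm_num
  refine suN_areaLawOnBallW_bakryEmery (n := 3) hN (by norm_num) (Real.log_pos (by norm_num))
    (by rw [habs]; norm_num) hmv ?_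
  rw [habs]
  have hE₀ := exp_le_taylor4 (x := (33 / 50 : ℝ)) (by norm_num) (by norm_num)
  have hEh : Real.exp ((33 / 50 : ℝ) / 2) ≤ 1 + 33 / 100 + (33 / 100) ^ 2 / 2 + (33 / 100) ^ 3 / 6 + 5 / 96 * (33 / 100) ^ 4 := by
    rw [show ((33 / 50 : ℝ) / 2) = 33 / 100 by norm_num]; exact exp_le_taylor4 (by norm_num) (by norm_num)
  have hs := le_sqrt_nat_mul hN (D := 1 / 2 - 3 / 32) (s₀ := 9 / 10) (by norm_num) (by norm_num) (by norm_num)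
  have h := suN_row_lt_one_of_bounds (w := Real.log (6 / 5) / 3) (ε₁ := 33 / 100) (q := (3 / 32) / (1 / 2 - 3 / 32)) (by norm_num) (by norm_num)
    exp_log_six_fifths_div_three_le hE₀ hEh (by norm_num) hs (by norm_num)
  calc Real.exp (Real.log (6 / 5) / ((3 : ℕ) : ℝ)) * (Real.exp (33 / 50) * (3 / 32 : ℝ) / (1 / 2 - 3 / 32)) +
        Real.exp (33 / 50 / 2) * (33 / 100) / Real.sqrt ((N : ℝ) * (1 / 2 - 3 / 32))
      = Real.exp (Real.log (6 / 5) / 3) * (Real.exp (33 / 50) * ((3 / 32 : ℝ) / (1 / 2 - 3 / 32))) +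
          Real.exp (33 / 50 / 2) * (33 / 100) / Real.sqrt ((N : ℝ) * (1 / 2 - 3 / 32)) := by push_cast; ring
    _ < 1 := h

/-- **ALL-`N` TIER-2 AREA-LAW ROW, `d = 4`, row-1f radii**: 't Hooft `β_tH = 1/30` (`R = 1/5`), weight `κ = log(6/5)`, `(ε₀, ε₁) = (1/10, 1/10)`
— for EVERY `N ≥ 2` and `mv ≥ 1`: `AreaLawOnBallW N 4 (N/30) (log(6/5)) (1/10) (1/10) mv`.  Certificate:
`1.0627·T₄(1/10)·(2/3) + T₄(1/20)·(1/10)/0.77 < 1`. [folklore] -/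
theorem suN_areaLawOnBallW_bakryEmery_dim4_row' (hN : 2 ≤ N) {mv : ℕ} (hmv : 1 ≤ mv) :
    AreaLawOnBallW N 4 ((N : ℝ) * (1 / 30)) (Real.log (6 / 5)) (1 / 10) (1 / 10) mv := by
  show AreaLawOnBallW N (3 + 1) _ _ _ _ mv
  have habs : |(1 / 30 : ℝ)| * (2 * ((3 : ℕ) : ℝ)) = 1 / 5 := by rw [abs_of_pos (by norm_num)]; push_cast; norm_num
  refine suN_areaLawOnBallW_bakryEmery (n := 3) hN (by norm_num) (Real.log_pos (by norm_num))
    (by rw [habs]; norm_num) hmv ?_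
  rw [habs]
  have hE₀ := exp_le_taylor4 (x := (1 / 10 : ℝ)) (by norm_num) (by norm_num)
  have hEh : Real.exp ((1 / 10 : ℝ) / 2) ≤ 1 + 1 / 20 + (1 / 20) ^ 2 / 2 + (1 / 20) ^ 3 / 6 + 5 / 96 * (1 / 20) ^ 4 := by
    rw [show ((1 / 10 : ℝ) / 2) = 1 / 20 by norm_num]; exact exp_le_taylor4 (by norm_num) (by norm_num)
  have hs := le_sqrt_nat_mul hN (D := 1 / 2 - 1 / 5) (s₀ := 77 / 100) (by norm_num) (by norm_num) (by norm_num)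
  have h := suN_row_lt_one_of_bounds (w := Real.log (6 / 5) / 3) (ε₁ := 1 / 10) (q := (1 / 5) / (1 / 2 - 1 / 5)) (by norm_num) (by norm_num)
    exp_log_six_fifths_div_three_le hE₀ hEh (by norm_num) hs (by norm_num)
  calc Real.exp (Real.log (6 / 5) / ((3 : ℕ) : ℝ)) * (Real.exp (1 / 10) * (1 / 5 : ℝ) / (1 / 2 - 1 / 5)) +
        Real.exp (1 / 10 / 2) * (1 / 10) / Real.sqrt ((N : ℝ) * (1 / 2 - 1 / 5))
      = Real.exp (Real.log (6 / 5) / 3) * (Real.exp (1 / 10) * ((1 / 5 : ℝ) / (1 / 2 - 1 / 5))) +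
          Real.exp (1 / 10 / 2) * (1 / 10) / Real.sqrt ((N : ℝ) * (1 / 2 - 1 / 5)) := by push_cast; ring
    _ < 1 := h

end AllN

end Summit.Ventures.YMGap.RobustBall
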